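import Summits.ValiantsHypothesis.ValiantsHypothesis.Theorems.BarrierLeverTransversalMinorLayoutsFiniteCheck

/-!
# Route BarrierLever — conjecture TT (stmt-ValiantsHypothesis-19152): the locked-core engine in
# HEIGHT form

Helper file (`--supports stmt-ValiantsHypothesis-19152`; cell valiant-natproofs, rung V4, 𝒟-side of
door (c); seat val-np-p4 gen 10).  Closes NO item.  `FiniteCheck.tt_rank_le_of_lockedCore`
(val-np-p1 g8) reduces TT for all layouts with `r ≤ R` rows to the LOCKED pairs of injective
lower-set layouts with `r ≤ R` members.  Its double induction (on the height `h`, inside it on the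
number of members `r`) never increases the height: the literal-pair split R1 sends an unlocked pair at
height `h + 1` to a projected block at height `h` and a complementary block at height `h + 1` with
fewer members.  So the same proof gives the engine with a bound on the HEIGHT instead of the rank:

* `tt_height_le_of_lockedCore H₀` — if every locked pair of injective lower-set layouts at a height
  `h ≤ H₀` (necessarily `h < r`) is good, then EVERY injective pair at every height `h ≤ H₀` is good,
  for every number of rows `r`.

This is the tool for height slices «TT for `h ≤ H₀`, all `r`» (companion file: `H₀ = 4`).

WHAT THIS IS NOT: a reduction principle; nothing on TT / item 19761 / 19930 in general, on crux
stmt-ValiantsHypothesis-14610, or on `VP` versus `VNP`.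
-/

-- layout Summits/ValiantsHypothesis/ValiantsHypothesis forces the duplicated namespace component
set_option linter.dupNamespace false

open Matrix Finset

namespace Summit.ValiantsHypothesis.ValiantsHypothesis.Theorems.BarrierLever.FiniteCheck

open Summit.ValiantsHypothesis.ValiantsHypothesis.Theorems.BarrierLever.Compression

/-- **LOCKED-CORE ENGINE, HEIGHT FORM.**  Fix a height bound `H₀`.  Suppose the TT layout matrix is
nonsingular (for some `H`) for every LOCKED pair of injective lower-set layouts at a height
`h ≤ H₀` with `h < r` — locked meaning that no literal class `{i : (a ∈ u i) = β}` of the rows has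
the size of a literal class `{j : (c ∈ w j) = γ}` of the columns.  Then the TT layout matrix is
nonsingular for EVERY pair of injective layouts at every height `h ≤ H₀`, for every `r`.  Proof:
val-np-p1 g8's double induction for `tt_rank_le_of_lockedCore`, verbatim, with the rank bound replaced
by the height bound (induction on `h`, inside it strong induction on `r`; reduce to lower sets at
fixed `(h, r)`; a locked pair is a core case, by `height_lt_of_locked` at `h < r`; an unlocked pair is
re-indexed into block form and split by R1, `LiteralSplit.transversalLiteralPairSplit_route`, into a
projected block one dimension DOWN and a complementary block at the same height with fewer members). -/
theorem tt_height_le_of_lockedCore (H₀ : ℕ)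
    (core : ∀ (h r : ℕ), h ≤ H₀ → h < r → ∀ (u w : Fin r → Finset (Fin h)), Function.Injective u →
      Function.Injective w → IsLowerSet (Set.range u) → IsLowerSet (Set.range w) →
      (∀ (a c : Fin h) (β γ : Bool),
        (Finset.univ.filter fun i => (a ∈ u i ↔ β = true)).card ≠
          (Finset.univ.filter fun j => (c ∈ w j ↔ γ = true)).card) →
      ∃ H : Matrix (Fin (h + h)) (Fin (h + h)) ℂ, (Matrix.of fun i j : Fin r => (H.submatrix
        (fun b : Fin h => if b ∈ u i then Fin.castAdd h b else Fin.natAdd h b)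
        (fun b : Fin h => if b ∈ w j then Fin.natAdd h b else Fin.castAdd h b)).det).det ≠ 0)
    (h : ℕ) (hh : h ≤ H₀) (r : ℕ) (u w : Fin r → Finset (Fin h)) (hu : Function.Injective u)
    (hw : Function.Injective w) :
    ∃ H : Matrix (Fin (h + h)) (Fin (h + h)) ℂ, (Matrix.of fun i j : Fin r => (H.submatrix
      (fun b : Fin h => if b ∈ u i then Fin.castAdd h b else Fin.natAdd h b)
      (fun b : Fin h => if b ∈ w j then Fin.natAdd h b else Fin.castAdd h b)).det).det ≠ 0 := by
  classical
  induction h generalizing r with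
  | zero =>
    rcases Nat.eq_zero_or_pos r with hr0 | hrpos
    · subst hr0
      exact ⟨0, by simp [Matrix.det_isEmpty]⟩
    refine tt_sameSize_of_lowerSets 0 r (fun u w hu hw hlu hlw => ?_) u w hu hw
    have hlk : ∀ (a c : Fin 0) (β γ : Bool),
        (Finset.univ.filter fun i => (a ∈ u i ↔ β = true)).card ≠
          (Finset.univ.filter fun j => (c ∈ w j ↔ γ = true)).card := fun a => Fin.elim0 a
    exact core 0 r hh (height_lt_of_locked u w hlu hlw hrpos hlk) u w hu hw hlu hlw hlk
  | succ h ih =>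
    induction r using Nat.strong_induction_on with
    | _ r ihr =>
    refine tt_sameSize_of_lowerSets (h + 1) r (fun u w hu hw hlu hlw => ?_) u w hu hw
    -- size 0 is trivial
    rcases Nat.eq_zero_or_pos r with hr0 | hrpos
    · subst hr0
      exact ⟨0, by simp [Matrix.det_isEmpty]⟩
    by_cases hlk : ∀ (a c : Fin (h + 1)) (β γ : Bool),
        (Finset.univ.filter fun i => (a ∈ u i ↔ β = true)).card ≠
          (Finset.univ.filter fun j => (c ∈ w j ↔ γ = true)).card
    · exact core (h + 1) r hh (height_lt_of_locked u w hlu hlw hrpos hlk) u w hu hw hlu hlw hlk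
    push Not at hlk
    -- an unlocked pair: classes of equal POSITIVE size `k`
    obtain ⟨a, c, β, γ, hkpos, hk⟩ : ∃ (a c : Fin (h + 1)) (β γ : Bool),
        0 < (Finset.univ.filter fun i => (a ∈ u i ↔ β = true)).card ∧
        (Finset.univ.filter fun i => (a ∈ u i ↔ β = true)).card =
          (Finset.univ.filter fun j => (c ∈ w j ↔ γ = true)).card := by
      obtain ⟨a, c, β, γ, hk⟩ := hlk
      by_cases h0 : (Finset.univ.filter fun i => (a ∈ u i ↔ β = true)).card = 0
      · refine ⟨a, c, !β, !γ, ?_, ?_⟩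
        · rw [card_filter_iff_not, h0]; omega
        · rw [card_filter_iff_not, card_filter_iff_not, ← hk]
      · exact ⟨a, c, β, γ, Nat.pos_of_ne_zero h0, hk⟩
    obtain ⟨k, hSk⟩ : ∃ k, (Finset.univ.filter fun i => (a ∈ u i ↔ β = true)).card = k :=
      ⟨_, rfl⟩
    obtain ⟨m, hkm⟩ : ∃ m, r = k + m := ⟨r - k, by
      have := Finset.card_le_univ (Finset.univ.filter fun i => (a ∈ u i ↔ β = true))
      simp only [Fintype.card_fin] at this; omega⟩
    subst hkm
    set S : Finset (Fin (k + m)) := Finset.univ.filter fun i => (a ∈ u i ↔ β = true) with hSdef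
    set T : Finset (Fin (k + m)) := Finset.univ.filter fun j => (c ∈ w j ↔ γ = true) with hTdef
    have hTk : T.card = k := hk.symm.trans hSk
    -- block re-indexings
    obtain ⟨σ, hσ1, hσ2⟩ := exists_blockPerm S hSk
    obtain ⟨τ, hτ1, hτ2⟩ := exists_blockPerm T hTk
    have hS : ∀ i, σ i ∈ S ↔ (a ∈ u (σ i) ↔ β = true) := fun i => by
      rw [hSdef, Finset.mem_filter]; simp
    have hT : ∀ j, τ j ∈ T ↔ (c ∈ w (τ j) ↔ γ = true) := fun j => by
      rw [hTdef, Finset.mem_filter]; simp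
    refine tt_layout_of_perm (h + 1) (k + m) u w σ τ ?_
    refine LiteralSplit.transversalLiteralPairSplit_route h k m (fun i => u (σ i)) (fun j => w (τ j))
      a c β γ ?_ ?_ ?_ ?_ ?_ ?_
    · intro i; exact (hS _).mp (hσ1 i)
    · intro i
      have hn := hσ2 i
      rw [hS] at hn
      revert hn
      cases β <;> simp
    · intro j; exact (hT _).mp (hτ1 j)
    · intro j
      have hn := hτ2 j
      rw [hT] at hn
      revert hn
      cases γ <;> simp
    · -- projected k-block, one dimension DOWN (height `h ≤ H₀`)
      refine ih (by omega) k _ _ ?_ ?_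
      · refine proj_injective_of_const_bit (fun i => u (σ (Fin.castAdd m i))) ?_ a β
          (fun i => (hS _).mp (hσ1 i))
        intro i j hij
        exact Fin.castAdd_injective _ _ (σ.injective (hu hij))
      · refine proj_injective_of_const_bit (fun j => w (τ (Fin.castAdd m j))) ?_ c γ
          (fun j => (hT _).mp (hτ1 j))
        intro i j hij
        exact Fin.castAdd_injective _ _ (τ.injective (hw hij))
    · -- complementary m-block, same height, fewer members
      refine ihr m (by omega) _ _ ?_ ?_
      · intro i j hij
        exact Fin.natAdd_injective _ _ (σ.injective (hu hij))
      · intro i j hij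
        exact Fin.natAdd_injective _ _ (τ.injective (hw hij))

end Summit.ValiantsHypothesis.ValiantsHypothesis.Theorems.BarrierLever.FiniteCheck
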